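import Literature.MathematicalPhysics.QuantumFieldTheory.WilsonFinTorusSpectralData
import Literature.Analysis.OperatorTheory.HeterogeneousCyclicPeeling
import HarnessLib

/-!
# 't Hooft's temporally twisted Wilson partition function of the anisotropic box and its time slicing

Part 4 of the transfer-matrix formalism for Wilson's lattice gauge theory on an ANISOTROPIC spatial box
`b₁ × b₂ × b₃` (parts 1–3: `WilsonFinTorusSliceKernel.lean` — slicing along the last axis, slab energies, the
slice kernel `finTorusSliceKernel`; `WilsonFinTorusSliceChain.lean` — the cyclic kernel chain `Z = ∫ ∏ₜ K(Vₜ, Vₜ₊₁)`;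
`WilsonFinTorusSpectralData.lean` — Lüscher positivity and `Z = Σ λᵢ^m`).  The cubic-torus sibling with `ZMod`-indexed
sites is `TwistedPartitionFunction.lean` / `TwistedPartitionFunctionRPBound.lean` (Tomboulis–Yaffe / Kanazawa).

't Hooft's twisted partition function ('t Hooft 1979, §2 (2.3)–(2.6): functional integral over fields periodic up
to centre-valued transition functions; on the lattice — Greensite 2011 §4.4 (4.41)–(4.44), Tomboulis–Yaffe 1985 — the
Wilson action with the plaquette holonomy `U_p` replaced by `z U_p` on ONE coclosed stack of plaquettes of a plane):
here the TEMPORAL twist of the box `n₀ × n₁ × n₂ × n₃` (time = the last axis) by `z = (z 0, z 1, z 2)`, acting on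
the stack `{x₃ = 0, x_μ = 0}` of `(μ, 3)`-plaquettes, `μ = 0, 1, 2` — the object `twistedColdZ` posited by the
`BalabanLadder.IR` crux lines `flux-purity-split` / `heavy-twist` of `Summits/QuantumFields/YangMills` (the twist
factor `tHooftTwistFactor` below is their `twistFactor` verbatim, so that
`twistedColdZ ρ β z L t = wilsonFinTorusTwistedPartition ρ β z L L L t` is `rfl`).

Contents (all PROVED; bookkeeping identities of the transfer-matrix formalism, no expansion, no estimate):

* `wilsonFinTorusTwistedPartition ρ β z n₀ n₁ n₂ n₃`; no twist is Wilson's partition function (`…_one`); positivity;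
* the SLICE TWIST `finSliceTwist z` — multiply the `i`-links of the sheet `{p_i = 0}` of one time slice by `z i`
  ('t Hooft's singular centre "gauge transformation" `Ω[k]`, 't Hooft 1979 §4 (4.2): a gauge rotation periodic up to
  a centre element): `finSliceTwist 1 = id`, composition, it PRESERVES the product Haar measure
  (`measurePreserving_finSliceTwist`), and for CENTRAL `z` it leaves the spatial plaquette energy, the temporal
  plaquette energy and hence the slice kernel invariant
  (`finTorusSpatialAction_finSliceTwist`, `finTorusTemporalAction_finSliceTwist`, `finTorusSliceKernel_finSliceTwist`:
  every plaquette contains `0` or `2` oppositely oriented twisted links) — i.e. the twist operator commutes with the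
  transfer matrix;
* the TWISTED TIME SLICING ('t Hooft 1979 §5 (5.1)–(5.4): "`Tr Ω[k] e^{−βH} = W{k, m; a_μ}` — the operator `Ω[k]`
  inserted in the trace implies a twist in the periodicity"; Montvay–Münster §3.2.6 (3.145) for the slicing):
  `wilsonFinTorusTwistedPartition_eq_integral_prod_finTorusSliceKernel` —
  `Z^{(z)}(b₁,b₂,b₃,m) = ∫ ∏_{t : Fin m} K_β(T_z^{[t = 0]} V t, V (t+1)) ∏ₜ dVₜ` (the cyclic kernel chain with the bond
  leaving slice `0` twisted), every period `m`, every real `β`, continuous `ρ`, central `z`; and the iterate form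
  `wilsonFinTorusTwistedPartition_eq_integral_iterate` —
  `Z^{(z)}(b₁,b₂,b₃,M+2) = ∫ (κ^{[M+1]} K_β(·, x))(T_z x) dμ(x)`, `(κ f)(w) = ∫ K_β(w, y) f(y) dμ(y)` — which is
  VERBATIM the hypothesis `hz` of the kernel-level twisted trace formula (`Σᵢ λᵢ^M ∫ (κbᵢ)∘T_z · κbᵢ`) over the
  eigen-data of `exists_spectralData_wilsonFinTorusPartition_box`.

HONEST FRAMING: nothing here is an estimate of a twisted or untwisted partition function, a statement about electric
flux free energies, confinement, a lattice mass gap or the Yang–Mills mass gap; these are the measure-theoretic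
identities "twist = centre operator inserted in the transfer-matrix trace" for Wilson's action.

References: G. 't Hooft, Nucl. Phys. B 153 (1979) 141, §§2, 4, 5; E. T. Tomboulis, L. G. Yaffe, Commun. Math. Phys.
100 (1985) 313; J. Greensite, *An Introduction to the Confinement Problem*, LNP 821 (2011) §4.4; I. Montvay,
G. Münster, *Quantum Fields on a Lattice* (1994) §3.2.6; M. Lüscher, Commun. Math. Phys. 54 (1977) 283.
-/

noncomputable section

open scoped BigOperators ENNReal
open MeasureTheory Filter Function
open Literature.Barriers.QuantumFields Literature.Analysis.OperatorTheory

namespace Literature.MathematicalPhysics.QuantumFieldTheory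

/-! ### 't Hooft's temporal twist of the anisotropic four-torus -/

section Defs

variable {G : Type*} [Group G]

/-- The four coordinates of a site of the `Fin`-torus `n₀ × n₁ × n₂ × n₃`, read as natural numbers. [folklore] -/
def finTorusSiteCoord {n₀ n₁ n₂ n₃ : ℕ} (x : FinTorusSite n₀ n₁ n₂ n₃) : Fin 4 → ℕ :=
  ![(x.1 : ℕ), (x.2.1 : ℕ), (x.2.2.1 : ℕ), (x.2.2.2 : ℕ)]

/-- **'t Hooft's temporal twist factor.**  The plaquette at site `x` with orientation `(μ, ν)` is multiplied by
`z μ` iff it is a temporal plaquette (`ν = 3`, time = the last axis) of the ONE stack `x₃ = 0`, `x_μ = 0` (all values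
of the two remaining coordinates); every other plaquette is untouched (`z 3` is never read).  On the lattice a twist
in the plane `(μ, 3)` is exactly this replacement `U_p ↦ z_μ U_p` on one coclosed stack of `(μ, 3)`-plaquettes
(Greensite (4.41)/(4.43); for central `z μ` the position of the stack is immaterial).  Verbatim the `twistFactor`
of the `BalabanLadder.IR` crux lines `flux-purity-split` / `heavy-twist`.
[cite: tHooft1979Flux, §2 (2.3)–(2.6)] [cite: Greensite2011, §4.4 (4.41)–(4.43)] -/
def tHooftTwistFactor (z : Fin 4 → G) {n₀ n₁ n₂ n₃ : ℕ} (x : FinTorusSite n₀ n₁ n₂ n₃) (μ ν : Fin 4) : G :=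
  if ν = 3 ∧ finTorusSiteCoord x 3 = 0 ∧ finTorusSiteCoord x μ = 0 then z μ else 1

/-- No twist: the factor of `z = 1` is `1` on every plaquette. [folklore] -/
@[simp] private theorem tHooftTwistFactor_one {n₀ n₁ n₂ n₃ : ℕ} (x : FinTorusSite n₀ n₁ n₂ n₃) (μ ν : Fin 4) :
    tHooftTwistFactor (1 : Fin 4 → G) x μ ν = 1 := by
  unfold tHooftTwistFactor
  split <;> simp

variable {n : ℕ} (ρ : G →* Matrix (Fin n) (Fin n) ℂ) [TopologicalSpace G] [IsTopologicalGroup G] [CompactSpace G]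
  [MeasurableSpace G] [BorelSpace G]

/-- **'t Hooft's temporally twisted Wilson partition function of the anisotropic box `n₀ × n₁ × n₂ × n₃`**, twist
`z = (z 0, z 1, z 2)` in the three temporal planes: VERBATIM `wilsonFinTorusPartition ρ β n₀ n₁ n₂ n₃` with the
plaquette holonomy `U_{x,μν}` replaced by `tHooftTwistFactor z x μ ν · U_{x,μν}` — 't Hooft's `W{k, m = 0; a_μ}`
((2.6)) on the lattice (Greensite (4.44): `Z₋` for `SU(2)`, `z = −1`).  For the crux lines of `BalabanLadder.IR`,
`twistedColdZ ρ β z L t` is `wilsonFinTorusTwistedPartition ρ β z L L L t` by `rfl`.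
[cite: tHooft1979Flux, §2 (2.6)] [cite: Greensite2011, §4.4 (4.44)] -/
def wilsonFinTorusTwistedPartition (β : ℝ) (z : Fin 4 → G) (n₀ n₁ n₂ n₃ : ℕ) : ℝ :=
  ∫ U, Real.exp (-β * ∑ x : FinTorusSite n₀ n₁ n₂ n₃, ∑ q : {q : Fin 4 × Fin 4 // q.1 < q.2},
      ((n : ℝ) - (ρ (tHooftTwistFactor z x q.1.1 q.1.2 * finTorusPlaquette U x q.1.1 q.1.2)).trace.re))
    ∂(Measure.pi fun _ : FinTorusSite n₀ n₁ n₂ n₃ × Fin 4 => haarProbability G)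

/-- **No twist is Wilson's partition function**: `Z^{(1)} = Z`. [cite: tHooft1979Flux, §2 (2.6)] -/
theorem wilsonFinTorusTwistedPartition_one (β : ℝ) (n₀ n₁ n₂ n₃ : ℕ) :
    wilsonFinTorusTwistedPartition ρ β (1 : Fin 4 → G) n₀ n₁ n₂ n₃ = wilsonFinTorusPartition ρ β n₀ n₁ n₂ n₃ := by
  simp [wilsonFinTorusTwistedPartition, wilsonFinTorusPartition]

omit [CompactSpace G] [MeasurableSpace G] [BorelSpace G] in
/-- Continuity of the twisted Wilson weight in the link configuration (a finite sum of continuous functions of the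
links under `exp`). [cite: MontvayMunster1994, §3.2.2 (3.65)] -/
theorem continuous_finTorusTwistedWeight (hρ : Continuous ρ) (β : ℝ) (z : Fin 4 → G) {n₀ n₁ n₂ n₃ : ℕ} :
    Continuous fun U : FinTorusSite n₀ n₁ n₂ n₃ × Fin 4 → G =>
      Real.exp (-β * ∑ x : FinTorusSite n₀ n₁ n₂ n₃, ∑ q : {q : Fin 4 × Fin 4 // q.1 < q.2},
        ((n : ℝ) - (ρ (tHooftTwistFactor z x q.1.1 q.1.2 * finTorusPlaquette U x q.1.1 q.1.2)).trace.re)) := by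
  have hU : ∀ l : FinTorusSite n₀ n₁ n₂ n₃ × Fin 4,
      Continuous fun U : FinTorusSite n₀ n₁ n₂ n₃ × Fin 4 → G => U l := fun l => continuous_apply l
  have hpl : ∀ (x : FinTorusSite n₀ n₁ n₂ n₃) (μ ν : Fin 4),
      Continuous fun U : FinTorusSite n₀ n₁ n₂ n₃ × Fin 4 → G => finTorusPlaquette U x μ ν := fun x μ ν =>
    (((hU _).mul (hU _)).mul (hU _).inv).mul (hU _).inv
  have htr : Continuous fun g : G => (ρ g).trace.re := Complex.continuous_re.comp (Continuous.matrix_trace hρ)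
  exact Real.continuous_exp.comp (continuous_const.mul (continuous_finsetSum _ fun x _ =>
    continuous_finsetSum _ fun q _ => continuous_const.sub (htr.comp (continuous_const.mul (hpl x _ _)))))

/-- **The twisted partition function is strictly positive** (a positive continuous integrand against a probability
measure). [cite: tHooft1979Flux, §2 (2.6)] -/
theorem wilsonFinTorusTwistedPartition_pos [SecondCountableTopology G] (hρ : Continuous ρ) (β : ℝ) (z : Fin 4 → G)
    (n₀ n₁ n₂ n₃ : ℕ) : 0 < wilsonFinTorusTwistedPartition ρ β z n₀ n₁ n₂ n₃ := by
  unfold wilsonFinTorusTwistedPartition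
  exact integral_exp_pos ((continuous_finTorusTwistedWeight ρ hρ β z).integrable_of_hasCompactSupport
    (IsCompact.of_isClosed_subset isCompact_univ (isClosed_tsupport _) (Set.subset_univ _)))

end Defs

/-! ### The slice twist: 't Hooft's centre operator on the spatial links of one time slice -/

section SliceTwist

variable {b₁ b₂ b₃ : ℕ} {G : Type*} [Group G]

/-- The three coordinates of a spatial site `p : Fin b₁ × Fin b₂ × Fin b₃`, read as natural numbers. [folklore] -/
def finSpatialCoord (p : FinSpatialSite b₁ b₂ b₃) : Fin 3 → ℕ := ![(p.1 : ℕ), (p.2.1 : ℕ), (p.2.2 : ℕ)]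

/-- A shift in direction `i` does not change the other coordinates. [folklore] -/
private theorem finSpatialCoord_shift_of_ne (p : FinSpatialSite b₁ b₂ b₃) {i j : Fin 3} (h : j ≠ i) :
    finSpatialCoord (p.shift i) j = finSpatialCoord p j := by
  fin_cases i <;> fin_cases j <;> first | exact absurd rfl h | rfl

/-- The time slice of the site `(p, t)` has coordinate `x₃ = t`. [folklore] -/
private theorem finTorusSiteCoord_toSite_three {m : ℕ} (p : FinSpatialSite b₁ b₂ b₃) (t : Fin m) :
    finTorusSiteCoord (p.toSite t) 3 = (t : ℕ) := rfl

/-- The spatial coordinates of the site `(p, t)` are those of `p`. [folklore] -/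
private theorem finTorusSiteCoord_toSite_castSucc {m : ℕ} (p : FinSpatialSite b₁ b₂ b₃) (t : Fin m) (i : Fin 3) :
    finTorusSiteCoord (p.toSite t) i.castSucc = finSpatialCoord p i := by
  fin_cases i <;> rfl

/-- **The link twist factor**: the `i`-link at the spatial site `p` is multiplied by `z i` iff `p_i = 0` (a sheet of
links crossing the plane `{x_i = 0}`; 't Hooft's `Ω[k]`, (4.2), is a gauge rotation that jumps by the centre element
across such a plane). [cite: tHooft1979Flux, §4 (4.2)] -/
def finSliceTwistFactor (z : Fin 4 → G) (l : FinSpatialSite b₁ b₂ b₃ × Fin 3) : G :=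
  if finSpatialCoord l.1 l.2 = 0 then z l.2.castSucc else 1

/-- **The slice twist** `T_z`: multiply every `i`-link of the sheet `{p_i = 0}` of a time slice by `z i` (left
multiplication; for central `z` the side is immaterial). [cite: tHooft1979Flux, §4 (4.2)] -/
def finSliceTwist (z : Fin 4 → G) (a : FinSpatialSite b₁ b₂ b₃ × Fin 3 → G) :
    FinSpatialSite b₁ b₂ b₃ × Fin 3 → G :=
  fun l => finSliceTwistFactor z l * a l

/-- `(T_z a)_l = (twist factor of l) · a_l`. [folklore] -/
@[simp] private theorem finSliceTwist_apply (z : Fin 4 → G) (a : FinSpatialSite b₁ b₂ b₃ × Fin 3 → G)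
    (l : FinSpatialSite b₁ b₂ b₃ × Fin 3) : finSliceTwist z a l = finSliceTwistFactor z l * a l := rfl

/-- The twist factor of `z = 1` is `1`. [folklore] -/
@[simp] private theorem finSliceTwistFactor_one (l : FinSpatialSite b₁ b₂ b₃ × Fin 3) :
    finSliceTwistFactor (1 : Fin 4 → G) l = 1 := by
  unfold finSliceTwistFactor
  split <;> simp

/-- The twist factor is multiplicative in `z`. [folklore] -/
private theorem finSliceTwistFactor_mul (z w : Fin 4 → G) (l : FinSpatialSite b₁ b₂ b₃ × Fin 3) :
    finSliceTwistFactor (z * w) l = finSliceTwistFactor z l * finSliceTwistFactor w l := by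
  unfold finSliceTwistFactor
  by_cases h : finSpatialCoord l.1 l.2 = 0 <;> simp [h]

/-- The twist factor of `z⁻¹` is the inverse factor. [folklore] -/
private theorem finSliceTwistFactor_inv (z : Fin 4 → G) (l : FinSpatialSite b₁ b₂ b₃ × Fin 3) :
    finSliceTwistFactor z⁻¹ l = (finSliceTwistFactor z l)⁻¹ := by
  unfold finSliceTwistFactor
  by_cases h : finSpatialCoord l.1 l.2 = 0 <;> simp [h]

/-- For central `z 0, z 1, z 2` every link twist factor is central. [folklore] -/
private theorem finSliceTwistFactor_mem_center {z : Fin 4 → G} (hz : ∀ i : Fin 3, z i.castSucc ∈ Subgroup.center G)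
    (l : FinSpatialSite b₁ b₂ b₃ × Fin 3) : finSliceTwistFactor z l ∈ Subgroup.center G := by
  unfold finSliceTwistFactor
  split
  · exact hz _
  · exact Subgroup.one_mem _

/-- **No twist is the identity**: `T_1 = id` (the trivial class `k = 0` of 't Hooft's `Ω[k]`).
[cite: tHooft1979Flux, §4 (4.2)–(4.4)] -/
theorem finSliceTwist_one :
    (finSliceTwist (1 : Fin 4 → G) : (FinSpatialSite b₁ b₂ b₃ × Fin 3 → G) → _) = id := by
  funext a l
  simp

/-- **Composition of twists**: `T_z ∘ T_w = T_{zw}` ('t Hooft's group law `Ω[k₁] Ω[k₂] = Ω[k₁ + k₂]`, (4.4)).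
[cite: tHooft1979Flux, §4 (4.4)] -/
theorem finSliceTwist_finSliceTwist (z w : Fin 4 → G) (a : FinSpatialSite b₁ b₂ b₃ × Fin 3 → G) :
    finSliceTwist z (finSliceTwist w a) = finSliceTwist (z * w) a := by
  funext l
  simp [finSliceTwistFactor_mul, mul_assoc]

/-- `T_z (T_{z⁻¹} a) = a` (the group law (4.4) at `k₂ = −k₁`). [cite: tHooft1979Flux, §4 (4.4)] -/
@[simp] theorem finSliceTwist_finSliceTwist_inv (z : Fin 4 → G) (a : FinSpatialSite b₁ b₂ b₃ × Fin 3 → G) :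
    finSliceTwist z (finSliceTwist z⁻¹ a) = a := by
  rw [finSliceTwist_finSliceTwist, mul_inv_cancel, finSliceTwist_one]
  rfl

/-- `T_{z⁻¹} (T_z a) = a` (the group law (4.4) at `k₂ = −k₁`). [cite: tHooft1979Flux, §4 (4.4)] -/
@[simp] theorem finSliceTwist_inv_finSliceTwist (z : Fin 4 → G) (a : FinSpatialSite b₁ b₂ b₃ × Fin 3 → G) :
    finSliceTwist z⁻¹ (finSliceTwist z a) = a := by
  rw [finSliceTwist_finSliceTwist, inv_mul_cancel, finSliceTwist_one]
  rfl

/-- **The slice twist preserves the product Haar measure** `∏_l dU_l` of a time slice: link by link it is a left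
translation `U ↦ V U`, and `∫ f(U) dU = ∫ f(VU) dU` (invariance of the Haar measure, Montvay–Münster (3.90); Mathlib
`measurePreserving_pi`). [cite: MontvayMunster1994, §3.2 (3.90)] -/
theorem measurePreserving_finSliceTwist [TopologicalSpace G] [IsTopologicalGroup G] [CompactSpace G]
    [MeasurableSpace G] [BorelSpace G] (z : Fin 4 → G) :
    MeasurePreserving (finSliceTwist z : (FinSpatialSite b₁ b₂ b₃ × Fin 3 → G) → _)
      (Measure.pi fun _ : FinSpatialSite b₁ b₂ b₃ × Fin 3 => haarProbability G)
      (Measure.pi fun _ : FinSpatialSite b₁ b₂ b₃ × Fin 3 => haarProbability G) :=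
  measurePreserving_pi (f := fun (l : FinSpatialSite b₁ b₂ b₃ × Fin 3) (x : G) => finSliceTwistFactor z l * x)
    (fun _ : FinSpatialSite b₁ b₂ b₃ × Fin 3 => haarProbability G)
    (fun _ : FinSpatialSite b₁ b₂ b₃ × Fin 3 => haarProbability G)
    fun l => measurePreserving_mul_left (haarProbability G) (finSliceTwistFactor z l)

/-! ### Central twists commute with the transfer matrix: invariance of the slab energies and of the kernel -/

/-- Conjugation by a central element is trivial: `c g c⁻¹ = g`. [folklore] -/
private theorem central_conj {c : G} (hc : c ∈ Subgroup.center G) (g : G) : c * g * c⁻¹ = g := by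
  rw [← Subgroup.mem_center_iff.mp hc g, mul_inv_cancel_right]

/-- A plaquette with two pairs of equally twisted, oppositely oriented links is untwisted (central factors):
`(c a₁)(d a₂)(c a₃)⁻¹(d a₄)⁻¹ = a₁ a₂ a₃⁻¹ a₄⁻¹`. [folklore] -/
private theorem twist_plaquette_cancel {c d : G} (hc : c ∈ Subgroup.center G) (hd : d ∈ Subgroup.center G)
    (a₁ a₂ a₃ a₄ : G) : c * a₁ * (d * a₂) * (c * a₃)⁻¹ * (d * a₄)⁻¹ = a₁ * a₂ * a₃⁻¹ * a₄⁻¹ := by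
  calc c * a₁ * (d * a₂) * (c * a₃)⁻¹ * (d * a₄)⁻¹
      = c * (a₁ * (d * a₂) * a₃⁻¹) * c⁻¹ * (a₄⁻¹ * d⁻¹) := by group
    _ = a₁ * (d * a₂) * a₃⁻¹ * (a₄⁻¹ * d⁻¹) := by rw [central_conj hc]
    _ = a₁ * (d * (a₂ * a₃⁻¹ * a₄⁻¹) * d⁻¹) := by group
    _ = a₁ * a₂ * a₃⁻¹ * a₄⁻¹ := by rw [central_conj hd]; group

/-- A temporal plaquette with both spatial links twisted by the same central factor is untwisted:
`(c a) g' (c b)⁻¹ g⁻¹ = a g' b⁻¹ g⁻¹`. [folklore] -/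
private theorem twist_temporal_cancel {c : G} (hc : c ∈ Subgroup.center G) (a g' b g : G) :
    c * a * g' * (c * b)⁻¹ * g⁻¹ = a * g' * b⁻¹ * g⁻¹ := by
  calc c * a * g' * (c * b)⁻¹ * g⁻¹ = c * (a * g' * b⁻¹) * c⁻¹ * g⁻¹ := by group
    _ = a * g' * b⁻¹ * g⁻¹ := by rw [central_conj hc]

/-- **Twisting a temporal plaquette is twisting its later spatial link**: for central `c`,
`c · (a g' b⁻¹ g⁻¹) = a g' (c⁻¹ b)⁻¹ g⁻¹`. [folklore] -/
private theorem central_mul_plaquette {c : G} (hc : c ∈ Subgroup.center G) (a g' b g : G) :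
    c * (a * g' * b⁻¹ * g⁻¹) = a * g' * (c⁻¹ * b)⁻¹ * g⁻¹ := by
  have h1 : g⁻¹ * c = c * g⁻¹ := Subgroup.mem_center_iff.mp hc g⁻¹
  calc c * (a * g' * b⁻¹ * g⁻¹) = a * g' * b⁻¹ * g⁻¹ * c := (Subgroup.mem_center_iff.mp hc _).symm
    _ = a * g' * b⁻¹ * (g⁻¹ * c) := by group
    _ = a * g' * b⁻¹ * (c * g⁻¹) := by rw [h1]
    _ = a * g' * (c⁻¹ * b)⁻¹ * g⁻¹ := by group

variable {N : ℕ} (ρ : G →* Matrix (Fin N) (Fin N) ℂ)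

/-- **A central slice twist leaves the spatial plaquette energy invariant**: every spatial plaquette `(i, j)` at `p`
contains the two `i`-links at `p` and `p + e_j` (same `i`-th coordinate, hence the same factor `z i` or `1`) with
opposite orientations, and likewise for its two `j`-links. [cite: tHooft1979Flux, §4 (4.2)–(4.3)] -/
theorem finTorusSpatialAction_finSliceTwist {z : Fin 4 → G} (hz : ∀ i : Fin 3, z i.castSucc ∈ Subgroup.center G)
    (a : FinSpatialSite b₁ b₂ b₃ × Fin 3 → G) :
    finTorusSpatialAction ρ (finSliceTwist z a) = finTorusSpatialAction ρ a := by
  unfold finTorusSpatialAction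
  refine Finset.sum_congr rfl fun p _ => Finset.sum_congr rfl fun q _ => ?_
  obtain ⟨⟨i, j⟩, hij⟩ := q
  have hne : i ≠ j := ne_of_lt hij
  have h1 : finSliceTwistFactor z (p.shift j, i) = finSliceTwistFactor z (p, i) := by
    simp only [finSliceTwistFactor, finSpatialCoord_shift_of_ne p hne]
  have h2 : finSliceTwistFactor z (p.shift i, j) = finSliceTwistFactor z (p, j) := by
    simp only [finSliceTwistFactor, finSpatialCoord_shift_of_ne p hne.symm]
  simp only [finSliceTwist_apply]
  rw [h1, h2, twist_plaquette_cancel (finSliceTwistFactor_mem_center hz _) (finSliceTwistFactor_mem_center hz _)]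

/-- **A central slice twist applied to BOTH slices leaves the temporal plaquette energy invariant** (the two spatial
links of a temporal plaquette carry the same factor, with opposite orientations). [cite: tHooft1979Flux, §4 (4.2)–(4.3)] -/
theorem finTorusTemporalAction_finSliceTwist {z : Fin 4 → G} (hz : ∀ i : Fin 3, z i.castSucc ∈ Subgroup.center G)
    (a : FinSpatialSite b₁ b₂ b₃ × Fin 3 → G) (g : FinSpatialSite b₁ b₂ b₃ → G)
    (b : FinSpatialSite b₁ b₂ b₃ × Fin 3 → G) :
    finTorusTemporalAction ρ (finSliceTwist z a) g (finSliceTwist z b) = finTorusTemporalAction ρ a g b := by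
  unfold finTorusTemporalAction
  refine Finset.sum_congr rfl fun p _ => Finset.sum_congr rfl fun i _ => ?_
  simp only [finSliceTwist_apply]
  rw [twist_temporal_cancel (finSliceTwistFactor_mem_center hz (p, i))]

/-- Moving a central twist across a slab: `S_tm(T_z a, g, b) = S_tm(a, g, T_{z⁻¹} b)`.
[cite: tHooft1979Flux, §4 (4.2)–(4.3)] -/
theorem finTorusTemporalAction_finSliceTwist_left {z : Fin 4 → G}
    (hz : ∀ i : Fin 3, z i.castSucc ∈ Subgroup.center G) (a : FinSpatialSite b₁ b₂ b₃ × Fin 3 → G)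
    (g : FinSpatialSite b₁ b₂ b₃ → G) (b : FinSpatialSite b₁ b₂ b₃ × Fin 3 → G) :
    finTorusTemporalAction ρ (finSliceTwist z a) g b = finTorusTemporalAction ρ a g (finSliceTwist z⁻¹ b) := by
  have h := finTorusTemporalAction_finSliceTwist ρ hz a g (finSliceTwist z⁻¹ b)
  rwa [finSliceTwist_finSliceTwist_inv] at h

variable [TopologicalSpace G] [IsTopologicalGroup G] [CompactSpace G] [MeasurableSpace G] [BorelSpace G]

/-- **The twist operator commutes with the transfer matrix**: for central `z` the slice kernel is invariant,
`K_β(T_z a, T_z b) = K_β(a, b)` — 't Hooft's `Ω[k]` "is an invariance of the Hamiltonian" ((4.3)); no change of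
variables in the temporal links is needed. [cite: tHooft1979Flux, §4 (4.2)–(4.3)] -/
theorem finTorusSliceKernel_finSliceTwist {z : Fin 4 → G} (hz : ∀ i : Fin 3, z i.castSucc ∈ Subgroup.center G)
    (β : ℝ) (a b : FinSpatialSite b₁ b₂ b₃ × Fin 3 → G) :
    finTorusSliceKernel ρ β (finSliceTwist z a) (finSliceTwist z b) = finTorusSliceKernel ρ β a b := by
  unfold finTorusSliceKernel
  simp_rw [finTorusTemporalAction_finSliceTwist ρ hz, finTorusSpatialAction_finSliceTwist ρ hz]

/-- Moving a central twist across a bond of the kernel chain: `K_β(T_z a, b) = K_β(a, T_{z⁻¹} b)`.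
[cite: tHooft1979Flux, §4 (4.2)–(4.3)] -/
theorem finTorusSliceKernel_finSliceTwist_left {z : Fin 4 → G}
    (hz : ∀ i : Fin 3, z i.castSucc ∈ Subgroup.center G) (β : ℝ) (a b : FinSpatialSite b₁ b₂ b₃ × Fin 3 → G) :
    finTorusSliceKernel ρ β (finSliceTwist z a) b = finTorusSliceKernel ρ β a (finSliceTwist z⁻¹ b) := by
  have h := finTorusSliceKernel_finSliceTwist ρ hz β a (finSliceTwist z⁻¹ b)
  rwa [finSliceTwist_finSliceTwist_inv] at h

end SliceTwist

/-! ### The twisted action of an assembled configuration splits over the slabs -/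

section Split

variable {b₁ b₂ b₃ m : ℕ} {G : Type*}

/-- `spatial (p, t) = p`. [folklore] -/
private theorem tw_spatial_toSite (p : FinSpatialSite b₁ b₂ b₃) (t : Fin m) : (p.toSite t).spatial = p := rfl

/-- `time (p, t) = t`. [folklore] -/
private theorem tw_time_toSite (p : FinSpatialSite b₁ b₂ b₃) (t : Fin m) : (p.toSite t).time = t := rfl

/-- A spatial shift of `(p, t)` is `(p + eᵢ, t)`. [folklore] -/
private theorem tw_toSite_shift_castSucc (p : FinSpatialSite b₁ b₂ b₃) (t : Fin m) (i : Fin 3) :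
    (p.toSite t).shift i.castSucc = (p.shift i).toSite t := by
  fin_cases i <;> rfl

/-- The temporal shift of `(p, t)` is `(p, t + 1)`. [folklore] -/
private theorem tw_toSite_shift_last (p : FinSpatialSite b₁ b₂ b₃) (t : Fin m) :
    (p.toSite t).shift (Fin.last 3) = p.toSite (finRotate m t) := rfl

/-- Spatial links of the assembled configuration. [folklore] -/
private theorem tw_assemble_castSucc
    (VE : (Fin m → (FinSpatialSite b₁ b₂ b₃ × Fin 3 → G)) × (Fin m → (FinSpatialSite b₁ b₂ b₃ → G)))
    (x : FinTorusSite b₁ b₂ b₃ m) (i : Fin 3) :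
    finTorusAssemble VE (x, i.castSucc) = VE.1 x.time (x.spatial, i) := by
  simp only [finTorusAssemble, Fin.lastCases_castSucc]

/-- Temporal links of the assembled configuration. [folklore] -/
private theorem tw_assemble_last
    (VE : (Fin m → (FinSpatialSite b₁ b₂ b₃ × Fin 3 → G)) × (Fin m → (FinSpatialSite b₁ b₂ b₃ → G)))
    (x : FinTorusSite b₁ b₂ b₃ m) :
    finTorusAssemble VE (x, Fin.last 3) = VE.2 x.time x.spatial := by
  simp only [finTorusAssemble, Fin.lastCases_last]

variable [Group G]

/-- A temporal plaquette of the assembled configuration. [folklore] -/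
private theorem tw_plaquette_temporal
    (VE : (Fin m → (FinSpatialSite b₁ b₂ b₃ × Fin 3 → G)) × (Fin m → (FinSpatialSite b₁ b₂ b₃ → G)))
    (p : FinSpatialSite b₁ b₂ b₃) (t : Fin m) (i : Fin 3) :
    finTorusPlaquette (finTorusAssemble VE) (p.toSite t) i.castSucc (Fin.last 3) =
      VE.1 t (p, i) * VE.2 t (p.shift i) * (VE.1 (finRotate m t) (p, i))⁻¹ * (VE.2 t p)⁻¹ := by
  simp only [finTorusPlaquette, tw_toSite_shift_castSucc, tw_toSite_shift_last, tw_assemble_castSucc,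
    tw_assemble_last, tw_spatial_toSite, tw_time_toSite]

/-- A spatial plaquette of the assembled configuration. [folklore] -/
private theorem tw_plaquette_spatial
    (VE : (Fin m → (FinSpatialSite b₁ b₂ b₃ × Fin 3 → G)) × (Fin m → (FinSpatialSite b₁ b₂ b₃ → G)))
    (p : FinSpatialSite b₁ b₂ b₃) (t : Fin m) (i j : Fin 3) :
    finTorusPlaquette (finTorusAssemble VE) (p.toSite t) i.castSucc j.castSucc =
      VE.1 t (p, i) * VE.1 t (p.shift i, j) * (VE.1 t (p.shift j, i))⁻¹ * (VE.1 t (p, j))⁻¹ := by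
  simp only [finTorusPlaquette, tw_toSite_shift_castSucc, tw_assemble_castSucc, tw_spatial_toSite, tw_time_toSite]

variable {N : ℕ} (ρ : G →* Matrix (Fin N) (Fin N) ℂ)

/-- Spatial plaquettes are never twisted. [cite: tHooft1979Flux, §2 (2.3)–(2.6)] -/
theorem tHooftTwistFactor_toSite_castSucc (z : Fin 4 → G) (p : FinSpatialSite b₁ b₂ b₃) (t : Fin m)
    (i j : Fin 3) : tHooftTwistFactor z (p.toSite t) i.castSucc j.castSucc = 1 := by
  have h : (j.castSucc : Fin 4) ≠ 3 := ne_of_lt (Fin.castSucc_lt_last j)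
  simp [tHooftTwistFactor, h]

/-- The temporal plaquette `(i, 3)` at `(p, t)` is twisted by the link twist factor of `(p, i)` iff `t = 0`.
[cite: tHooft1979Flux, §2 (2.3)–(2.6)] -/
theorem tHooftTwistFactor_toSite_last (z : Fin 4 → G) (p : FinSpatialSite b₁ b₂ b₃) (t : Fin m) (i : Fin 3) :
    tHooftTwistFactor z (p.toSite t) i.castSucc (Fin.last 3) =
      if (t : ℕ) = 0 then finSliceTwistFactor z (p, i) else 1 := by
  have h3 : (Fin.last 3 : Fin 4) = 3 := rfl
  simp only [tHooftTwistFactor, finSliceTwistFactor, h3, finTorusSiteCoord_toSite_three,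
    finTorusSiteCoord_toSite_castSucc, true_and]
  by_cases ht : (t : ℕ) = 0 <;> by_cases hp : finSpatialCoord p i = 0 <;> simp [ht, hp]

/-- **The twisted Wilson action of an assembled configuration is the sum of the slab energies, with the bond leaving
slice `0` twisted**: `Σ_x Σ_{μ<ν} (N − Re tr ρ(z_{x,μν} U_{x,μν})) = Σ_t S_tm(V t, E t, T_{z⁻¹}^{[t=0]} V (t+1)) + Σ_t S_sp(V t)`
for central `z` (a twisted temporal plaquette `z_i · a g' b⁻¹ g⁻¹` is the untwisted plaquette with the later spatial
link `b` replaced by `z_i⁻¹ b`). [cite: tHooft1979Flux, §5 (5.3)–(5.4)] [cite: MontvayMunster1994, §3.2.6 (3.139)–(3.142)] -/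
theorem finTorusTwistedAction_assemble {z : Fin 4 → G} (hz : ∀ i : Fin 3, z i.castSucc ∈ Subgroup.center G)
    (VE : (Fin m → (FinSpatialSite b₁ b₂ b₃ × Fin 3 → G)) × (Fin m → (FinSpatialSite b₁ b₂ b₃ → G))) :
    ∑ x : FinTorusSite b₁ b₂ b₃ m, ∑ q : {q : Fin 4 × Fin 4 // q.1 < q.2},
        ((N : ℝ) - (ρ (tHooftTwistFactor z x q.1.1 q.1.2 *
          finTorusPlaquette (finTorusAssemble VE) x q.1.1 q.1.2)).trace.re) =
      (∑ t : Fin m, finTorusTemporalAction ρ (VE.1 t) (VE.2 t)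
          (if (t : ℕ) = 0 then finSliceTwist z⁻¹ (VE.1 (finRotate m t)) else VE.1 (finRotate m t))) +
        ∑ t : Fin m, finTorusSpatialAction ρ (VE.1 t) := by
  rw [← (finTorusSiteSliceEquiv b₁ b₂ b₃ m).symm.sum_comp, Fintype.sum_prod_type, ← Finset.sum_add_distrib]
  refine Finset.sum_congr rfl fun t _ => ?_
  unfold finTorusTemporalAction finTorusSpatialAction
  rw [← Finset.sum_add_distrib]
  refine Finset.sum_congr rfl fun p _ => ?_
  have e : (finTorusSiteSliceEquiv b₁ b₂ b₃ m).symm (t, p) = p.toSite t := rfl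
  rw [e, sum_pairs_eq_sum_castSucc_last_add (g := fun μ ν =>
    (N : ℝ) - (ρ (tHooftTwistFactor z (p.toSite t) μ ν *
      finTorusPlaquette (finTorusAssemble VE) (p.toSite t) μ ν)).trace.re)]
  simp only [tw_plaquette_temporal, tw_plaquette_spatial, tHooftTwistFactor_toSite_castSucc,
    tHooftTwistFactor_toSite_last, one_mul]
  congr 1
  refine Finset.sum_congr rfl fun i _ => ?_
  by_cases ht : (t : ℕ) = 0
  · simp only [ht, if_true, finSliceTwist_apply, finSliceTwistFactor_inv]
    rw [central_mul_plaquette (finSliceTwistFactor_mem_center hz (p, i))]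
  · simp only [ht, if_false, one_mul]

/-- **The twisted Boltzmann weight factorises over the slabs** (with the bond leaving slice `0` twisted).
[cite: tHooft1979Flux, §5 (5.3)–(5.4)] [cite: MontvayMunster1994, §3.2.6 (3.142)–(3.143)] -/
theorem finTorusTwistedWeight_assemble {z : Fin 4 → G} (hz : ∀ i : Fin 3, z i.castSucc ∈ Subgroup.center G)
    (β : ℝ) (VE : (Fin m → (FinSpatialSite b₁ b₂ b₃ × Fin 3 → G)) × (Fin m → (FinSpatialSite b₁ b₂ b₃ → G))) :
    Real.exp (-β * ∑ x : FinTorusSite b₁ b₂ b₃ m, ∑ q : {q : Fin 4 × Fin 4 // q.1 < q.2},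
        ((N : ℝ) - (ρ (tHooftTwistFactor z x q.1.1 q.1.2 *
          finTorusPlaquette (finTorusAssemble VE) x q.1.1 q.1.2)).trace.re)) =
      (∏ t : Fin m, Real.exp (-(β * finTorusSpatialAction ρ (VE.1 t)))) *
        ∏ t : Fin m, Real.exp (-(β * finTorusTemporalAction ρ (VE.1 t) (VE.2 t)
          (if (t : ℕ) = 0 then finSliceTwist z⁻¹ (VE.1 (finRotate m t)) else VE.1 (finRotate m t)))) := by
  rw [finTorusTwistedAction_assemble ρ hz, neg_mul, mul_add, neg_add, Real.exp_add, Finset.mul_sum, Finset.mul_sum,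
    ← Finset.sum_neg_distrib, ← Finset.sum_neg_distrib, Real.exp_sum, Real.exp_sum, mul_comm]

end Split

/-! ### The twisted time slicing: cyclic kernel chain with one twisted bond, and the iterate form -/

section Chain

variable {b₁ b₂ b₃ m : ℕ} {G : Type*} [Group G] [TopologicalSpace G] [IsTopologicalGroup G] [CompactSpace G]
  [MeasurableSpace G] [BorelSpace G] {N : ℕ} (ρ : G →* Matrix (Fin N) (Fin N) ℂ)

/-- Symmetrisation of a cyclic chain with bond-dependent factors `Nf t` along a permutation `σ`:
`(∏_t e^{c m(V t)}) ∏_t Nf t = ∏_t e^{c m(V t)/2} Nf t e^{c m(V (σ t))/2}`. [folklore] -/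
private theorem prod_exp_mul_prod_eq_prod_symm_perm {ι X : Type*} [Fintype ι] (σ : Equiv.Perm ι) (mf : X → ℝ)
    (Nf : ι → ℝ) (c : ℝ) (V : ι → X) :
    (∏ t, Real.exp (c * mf (V t))) * ∏ t, Nf t =
      ∏ t, Real.exp (c / 2 * mf (V t)) * Nf t * Real.exp (c / 2 * mf (V (σ t))) := by
  rw [Finset.prod_mul_distrib, Finset.prod_mul_distrib]
  have hshift : ∏ t, Real.exp (c / 2 * mf (V (σ t))) = ∏ t, Real.exp (c / 2 * mf (V t)) :=
    Equiv.prod_comp σ fun t => Real.exp (c / 2 * mf (V t))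
  have hsq : (fun t => Real.exp (c * mf (V t))) =
      fun t => Real.exp (c / 2 * mf (V t)) * Real.exp (c / 2 * mf (V t)) := by
    funext t; rw [← Real.exp_add]; ring_nf
  rw [hshift, hsq, Finset.prod_mul_distrib]
  ring

/-- The symmetrised bond factor is the slice kernel, provided the later slice enters the spatial half-weight only
through its (twist-invariant) spatial energy. [cite: MontvayMunster1994, §3.2.6 (3.144)] -/
private theorem symm_factor_eq_finTorusSliceKernel (β : ℝ) (a b w : FinSpatialSite b₁ b₂ b₃ × Fin 3 → G)
    (hw : finTorusSpatialAction ρ w = finTorusSpatialAction ρ b) :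
    Real.exp (-β / 2 * finTorusSpatialAction ρ a) *
        (∫ g, Real.exp (-(β * finTorusTemporalAction ρ a g w))
          ∂(Measure.pi fun _ : FinSpatialSite b₁ b₂ b₃ => haarProbability G)) *
        Real.exp (-β / 2 * finTorusSpatialAction ρ b) =
      finTorusSliceKernel ρ β a w := by
  unfold finTorusSliceKernel
  rw [hw]
  congr 1
  · congr 1
    rw [show -β / 2 * finTorusSpatialAction ρ a = -(β * finTorusSpatialAction ρ a / 2) by ring]
  · rw [show -β / 2 * finTorusSpatialAction ρ b = -(β * finTorusSpatialAction ρ b / 2) by ring]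

/-- **Twisted time slicing — the cyclic kernel chain with one twisted bond** (continuous `ρ`, every real `β`, every
spatial box `b₁ × b₂ × b₃`, every period `m`, central `z`):
`Z^{(z)}(b₁,b₂,b₃,m) = ∫ ∏_{t : Fin m} K_β(T_z^{[t = 0]} (V t), V (t+1)) ∏ₜ dVₜ`, `t + 1 = finRotate m t` — the
path-space form of 't Hooft's `W{k; a} = Tr(Ω[k] e^{−βH})` ((5.3)–(5.4): "the operator `Ω[k]` is also inserted; it
implies a twist in the periodicity") for Wilson's action: slice the links, factorise the twisted weight (the twisted
temporal plaquettes of the slab `0` are untwisted plaquettes towards the twisted slice `T_{z⁻¹} V 1`), integrate out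
the temporal links slab by slab, symmetrise the spatial factors (`S_sp ∘ T = S_sp`), and move the twist across the
bond (`K(a, T_{z⁻¹} b) = K(T_z a, b)`). [cite: tHooft1979Flux, §5 (5.1)–(5.4)] [cite: MontvayMunster1994, §3.2.6 (3.145)] -/
theorem wilsonFinTorusTwistedPartition_eq_integral_prod_finTorusSliceKernel [SecondCountableTopology G]
    (hρ : Continuous ρ) (β : ℝ) {z : Fin 4 → G} (hz : ∀ i : Fin 3, z i.castSucc ∈ Subgroup.center G)
    (b₁ b₂ b₃ m : ℕ) :
    wilsonFinTorusTwistedPartition ρ β z b₁ b₂ b₃ m =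
      ∫ V : Fin m → (FinSpatialSite b₁ b₂ b₃ × Fin 3 → G),
        ∏ t : Fin m, finTorusSliceKernel ρ β (if (t : ℕ) = 0 then finSliceTwist z (V t) else V t) (V (finRotate m t))
        ∂(Measure.pi fun _ => Measure.pi fun _ : FinSpatialSite b₁ b₂ b₃ × Fin 3 => haarProbability G) := by
  have hz' : ∀ i : Fin 3, z⁻¹ i.castSucc ∈ Subgroup.center G := fun i => by
    rw [Pi.inv_apply]
    exact Subgroup.inv_mem _ (hz i)
  have hΦc := continuous_finTorusTwistedWeight (n₀ := b₁) (n₁ := b₂) (n₂ := b₃) (n₃ := m) ρ hρ β z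
  unfold wilsonFinTorusTwistedPartition
  rw [integral_pi_eq_integral_finTorusAssemble (haarProbability G) hΦc.measurable]
  have hint : Integrable (fun VE : (Fin m → (FinSpatialSite b₁ b₂ b₃ × Fin 3 → G)) ×
      (Fin m → (FinSpatialSite b₁ b₂ b₃ → G)) =>
        Real.exp (-β * ∑ x : FinTorusSite b₁ b₂ b₃ m, ∑ q : {q : Fin 4 × Fin 4 // q.1 < q.2},
          ((N : ℝ) - (ρ (tHooftTwistFactor z x q.1.1 q.1.2 *
            finTorusPlaquette (finTorusAssemble VE) x q.1.1 q.1.2)).trace.re)))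
      ((Measure.pi fun _ : Fin m => Measure.pi fun _ : FinSpatialSite b₁ b₂ b₃ × Fin 3 => haarProbability G).prod
        (Measure.pi fun _ : Fin m => Measure.pi fun _ : FinSpatialSite b₁ b₂ b₃ => haarProbability G)) :=
    (hΦc.comp continuous_finTorusAssemble).integrable_of_hasCompactSupport
      (IsCompact.of_isClosed_subset isCompact_univ (isClosed_tsupport _) (Set.subset_univ _))
  rw [integral_prod _ hint]
  refine integral_congr_ae (Eventually.of_forall fun V => ?_)
  dsimp only
  simp_rw [finTorusTwistedWeight_assemble ρ hz β]
  rw [integral_const_mul]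
  -- integrate out the temporal links slab by slab; the later slice of the bond leaving `t = 0` is `T_{z⁻¹} V 1`
  have hprod := integral_fintype_prod_eq_prod (𝕜 := ℝ)
    (μ := fun _ : Fin m => Measure.pi fun _ : FinSpatialSite b₁ b₂ b₃ => haarProbability G)
    (fun (t : Fin m) (g : FinSpatialSite b₁ b₂ b₃ → G) =>
      Real.exp (-(β * finTorusTemporalAction ρ (V t) g
        (if (t : ℕ) = 0 then finSliceTwist z⁻¹ (V (finRotate m t)) else V (finRotate m t)))))
  rw [hprod]
  have hsymm := prod_exp_mul_prod_eq_prod_symm_perm (finRotate m) (finTorusSpatialAction ρ)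
    (fun t => ∫ g, Real.exp (-(β * finTorusTemporalAction ρ (V t) g
        (if (t : ℕ) = 0 then finSliceTwist z⁻¹ (V (finRotate m t)) else V (finRotate m t))))
      ∂(Measure.pi fun _ : FinSpatialSite b₁ b₂ b₃ => haarProbability G)) (-β) V
  have e1 : (fun t : Fin m => Real.exp (-(β * finTorusSpatialAction ρ (V t)))) =
      fun t => Real.exp (-β * finTorusSpatialAction ρ (V t)) := by
    funext t; rw [neg_mul]
  rw [e1, hsymm]
  refine Finset.prod_congr rfl fun t _ => ?_
  by_cases ht : (t : ℕ) = 0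
  · simp only [ht, if_true]
    rw [symm_factor_eq_finTorusSliceKernel ρ β (V t) (V (finRotate m t)) (finSliceTwist z⁻¹ (V (finRotate m t)))
      (finTorusSpatialAction_finSliceTwist ρ hz' _), finTorusSliceKernel_finSliceTwist_left ρ hz]
  · simp only [ht, if_false]
    rw [symm_factor_eq_finTorusSliceKernel ρ β (V t) (V (finRotate m t)) (V (finRotate m t)) rfl]

/-- **Twisted time slicing — iterate form** (the shape consumed by the kernel-level twisted trace formula
`∫ (κ^{[M+1]} K(·,x))(T x) dμ = Σᵢ λᵢ^M ∫ (κbᵢ)(T x)(κbᵢ)(x) dμ`): for a box of period `M + 2`,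
`Z^{(z)}(b₁,b₂,b₃,M+2) = ∫ (κ^{[M+1]} K_β(·, x))(T_z x) dμ(x)`, `(κ f)(w) = ∫ K_β(w, y) f(y) dμ(y)`, `μ = ∏_l dU_l` — the
cyclic chain of `M + 2` slices from `T_z x` through `M + 1` intermediate slices back to `x` ('t Hooft's
`Tr(Ω[k] e^{−βH})`, (5.3), in path-space form; via the bond-insertion peeling `integral_cyclic_insert_one`).
[cite: tHooft1979Flux, §5 (5.1)–(5.4)] [cite: MontvayMunster1994, §3.2.6 (3.145)] -/
theorem wilsonFinTorusTwistedPartition_eq_integral_iterate [SecondCountableTopology G] (hρ : Continuous ρ)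
    (β : ℝ) {z : Fin 4 → G} (hz : ∀ i : Fin 3, z i.castSucc ∈ Subgroup.center G) (b₁ b₂ b₃ M : ℕ) :
    wilsonFinTorusTwistedPartition ρ β z b₁ b₂ b₃ (M + 2) =
      ∫ x, ((fun f : (FinSpatialSite b₁ b₂ b₃ × Fin 3 → G) → ℝ => fun w =>
            ∫ y, finTorusSliceKernel ρ β w y * f y
              ∂(Measure.pi fun _ : FinSpatialSite b₁ b₂ b₃ × Fin 3 => haarProbability G))^[M + 1]
          (fun y => finTorusSliceKernel ρ β y x)) (finSliceTwist z x)
        ∂(Measure.pi fun _ : FinSpatialSite b₁ b₂ b₃ × Fin 3 => haarProbability G) := by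
  have hKm : Measurable (uncurry (finTorusSliceKernel ρ β :
      (FinSpatialSite b₁ b₂ b₃ × Fin 3 → G) → (FinSpatialSite b₁ b₂ b₃ × Fin 3 → G) → ℝ)) :=
    (stronglyMeasurable_uncurry_finTorusSliceKernel ρ hρ β).measurable
  obtain ⟨C, hC⟩ := exists_norm_finTorusSliceKernel_le (b₁ := b₁) (b₂ := b₂) (b₃ := b₃) ρ hρ β
  have hT : Measurable (finSliceTwist z : (FinSpatialSite b₁ b₂ b₃ × Fin 3 → G) → _) :=
    (measurePreserving_finSliceTwist z).measurable
  -- (stated for a generic kernel `K`, so that unification never unfolds `finTorusSliceKernel`)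
  have hXm : ∀ {K : (FinSpatialSite b₁ b₂ b₃ × Fin 3 → G) → (FinSpatialSite b₁ b₂ b₃ × Fin 3 → G) → ℝ},
      Measurable (uncurry K) →
        Measurable (uncurry fun x y : (FinSpatialSite b₁ b₂ b₃ × Fin 3 → G) => K (finSliceTwist z x) y) :=
    fun hK => hK.comp ((hT.comp measurable_fst).prodMk measurable_snd)
  have hXb : ∀ x y : (FinSpatialSite b₁ b₂ b₃ × Fin 3 → G), ‖finTorusSliceKernel ρ β (finSliceTwist z x) y‖ ≤ C :=
    fun x y => hC _ _
  have h12 : M + 2 = 1 + M + 1 := by ring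
  rw [h12, wilsonFinTorusTwistedPartition_eq_integral_prod_finTorusSliceKernel ρ hρ β hz b₁ b₂ b₃ (1 + M + 1)]
  have hprod : ∀ V : Fin (1 + M + 1) → (FinSpatialSite b₁ b₂ b₃ × Fin 3 → G),
      ∏ t : Fin (1 + M + 1), finTorusSliceKernel ρ β (if (t : ℕ) = 0 then finSliceTwist z (V t) else V t)
          (V (finRotate (1 + M + 1) t)) =
        finTorusSliceKernel ρ β (finSliceTwist z (V 0)) (V 1) *
          ∏ t : Fin (1 + M), finTorusSliceKernel ρ β (V t.succ) (V (t.succ + 1)) := fun V => by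
    rw [Fin.prod_univ_succ]
    congr 1
    · simp
    · refine Finset.prod_congr rfl fun t _ => ?_
      have ht : ((t.succ : Fin (1 + M + 1)) : ℕ) ≠ 0 := by simp [Fin.val_succ]
      simp only [ht, if_false, finRotate_apply]
  simp_rw [hprod]
  rw [integral_cyclic_insert_one (hXm hKm) hKm hXb hC M]
  refine integral_congr_ae (Eventually.of_forall fun x => ?_)
  dsimp only
  rw [Function.iterate_succ_apply']

end Chain

/-! ### The eigenbasis of the transfer operator, exposed (the data the kernel-level trace formulas consume) -/

section Eigenbasis

variable {G : Type*} [Group G] [TopologicalSpace G] [IsTopologicalGroup G] [CompactSpace G]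
  [MeasurableSpace G] [BorelSpace G] [SecondCountableTopology G] {N : ℕ} {ρ : G →* Matrix (Fin N) (Fin N) ℂ}

/-- **The transfer operator of the anisotropic box and an eigenbasis, EXPOSED** (`β ≥ 0`, continuous unitary `ρ`):
there are a bound `C` of the slice kernel `K_β = finTorusSliceKernel ρ β`, its `L²` integral operator `A`
(`A φ = ∫ K_β(·, y) φ(y) dμ(y)` a.e., `μ = ∏_l dU_l`), a countable Hilbert basis `b` of `L²(μ)` of eigenvectors,
`A bᵢ = λᵢ bᵢ` (Hilbert–Schmidt theorem), with `0 ≤ λᵢ ≤ λ_{i₀} = ‖A‖ ≠ 0` (Lüscher positivity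
`posType_finTorusSliceKernel`, Jentzsch / Perron–Frobenius for the positivity-improving `A`).  This is the data behind
`exists_spectralData_wilsonFinTorusPartition_box` (which only exposes the eigenvalues), in the shape consumed by the
kernel-level trace formulas of `Literature.Analysis.OperatorTheory` (`hasSum_pow_integral_cyclic`,
`hasSum_pow_integral_iterate_diag`, and their twisted variants) together with
`wilsonFinTorusTwistedPartition_eq_integral_iterate`. [cite: Luscher1977] [cite: MontvayMunster1994, §3.2.6 (3.145)–(3.146)]
[cite: ReedSimonI1980, Thm. VI.16 and Thm. VI.22–23] -/
theorem exists_eigenbasis_finTorusSliceKernel (hρ : Continuous ρ) (hρu : ∀ g, ρ g ∈ Matrix.unitaryGroup (Fin N) ℂ)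
    {β : ℝ} (hβ : 0 ≤ β) (b₁ b₂ b₃ : ℕ) :
    ∃ (C : ℝ)
      (A : Lp ℝ 2 (Measure.pi fun _ : FinSpatialSite b₁ b₂ b₃ × Fin 3 => haarProbability G) →L[ℝ]
        Lp ℝ 2 (Measure.pi fun _ : FinSpatialSite b₁ b₂ b₃ × Fin 3 => haarProbability G))
      (s : Set (Lp ℝ 2 (Measure.pi fun _ : FinSpatialSite b₁ b₂ b₃ × Fin 3 => haarProbability G)))
      (_ : Countable s)
      (b : HilbertBasis s ℝ (Lp ℝ 2 (Measure.pi fun _ : FinSpatialSite b₁ b₂ b₃ × Fin 3 => haarProbability G)))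
      (lam : s → ℝ) (i₀ : s),
      (∀ x y : FinSpatialSite b₁ b₂ b₃ × Fin 3 → G, ‖finTorusSliceKernel ρ β x y‖ ≤ C) ∧
      (∀ φ : Lp ℝ 2 (Measure.pi fun _ : FinSpatialSite b₁ b₂ b₃ × Fin 3 => haarProbability G),
        (A φ : (FinSpatialSite b₁ b₂ b₃ × Fin 3 → G) → ℝ)
          =ᵐ[Measure.pi fun _ : FinSpatialSite b₁ b₂ b₃ × Fin 3 => haarProbability G] fun x =>
            ∫ y, finTorusSliceKernel ρ β x y * φ y
              ∂(Measure.pi fun _ : FinSpatialSite b₁ b₂ b₃ × Fin 3 => haarProbability G)) ∧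
      (∀ i, A (b i) = lam i • b i) ∧ (∀ i, 0 ≤ lam i ∧ lam i ≤ lam i₀) ∧ lam i₀ = ‖A‖ ∧ lam i₀ ≠ 0 := by
  set μ : Measure (FinSpatialSite b₁ b₂ b₃ × Fin 3 → G) :=
    Measure.pi fun _ : FinSpatialSite b₁ b₂ b₃ × Fin 3 => haarProbability G with hμ
  set K : (FinSpatialSite b₁ b₂ b₃ × Fin 3 → G) → (FinSpatialSite b₁ b₂ b₃ × Fin 3 → G) → ℝ :=
    finTorusSliceKernel ρ β with hKdef
  have hK : StronglyMeasurable (uncurry K) := stronglyMeasurable_uncurry_finTorusSliceKernel ρ hρ β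
  obtain ⟨C, hC⟩ := exists_norm_finTorusSliceKernel_le (b₁ := b₁) (b₂ := b₂) (b₃ := b₃) ρ hρ β
  have hsymm : ∀ x y, K x y = K y x := finTorusSliceKernel_symm ρ hρu β
  have hKpos : ∀ x y, 0 < K x y := finTorusSliceKernel_pos ρ hρ β
  -- the transfer operator on `L²` of the spatial links
  obtain ⟨A, hA⟩ := exists_kernelOp (μ := μ) hK hC
  have hsa : IsSelfAdjoint A := isSelfAdjoint_kernelOp hK hC hsymm hA
  have hC0 : 0 ≤ C := (norm_nonneg _).trans (hC 1 1)
  have hcpt : IsCompactOperator A := isCompactOperator_kernelOp hC hC0 hA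
  have himp : IsPositivityImproving A := isPositivityImproving_kernelOp hK hC hKpos hA
  have hA0 : A ≠ 0 := kernelOp_ne_zero hK hC hKpos (IsProbabilityMeasure.ne_zero _) hA
  -- an eigenbasis (Hilbert–Schmidt theorem), countable by separability of `L²`
  obtain ⟨s, b, lam, hbs, hb0⟩ := exists_hilbertBasis_eigenvectors_of_isSelfAdjoint hcpt hsa
  have hb : ∀ i, A (b i) = lam i • b i := fun i => by simpa using hb0 i
  haveI : Fact ((2 : ℝ≥0∞) ≠ ⊤) := ⟨ENNReal.ofNat_ne_top⟩
  have hon : Orthonormal ℝ ((↑) : s → Lp ℝ 2 μ) := hbs ▸ b.orthonormal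
  have hcnt : Countable s := (hon.countable_of_separableSpace (𝕜 := ℝ)).to_subtype
  -- non-negative eigenvalues (Lüscher), top eigenvalue `λ_{i₀} = ‖A‖ > 0` (Jentzsch)
  have hlam0 : ∀ i, 0 ≤ lam i := fun i => by
    rw [lam_eq_inner hb i]
    exact inner_kernelOp_self_nonneg hA (posType_finTorusSliceKernel ρ hρ hρu hβ) _
  obtain ⟨ψ, hψ0, hψ⟩ := himp.exists_top_eigenvector_of_isCompactOperator hsa hcpt hA0
  obtain ⟨i₀, hi₀⟩ := exists_index_eq_norm b hsa hb hψ0 hψ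
  have hle : ∀ i, lam i ≤ lam i₀ := fun i => (le_abs_self _).trans ((abs_lam_le_norm hb i).trans hi₀.ge)
  have hL0 : 0 < lam i₀ := by rw [hi₀]; exact norm_pos_iff.2 hA0
  exact ⟨C, A, s, hcnt, b, lam, i₀, hC, hA, hb, fun i => ⟨hlam0 i, hle i⟩, hi₀, hL0.ne'⟩

end Eigenbasis

/-! ### Convenience forms for consumers: the cyclic (one-marked-bond) chain and centre-valued twist families -/

section Consumer

variable {G : Type*} [Group G] [TopologicalSpace G] [IsTopologicalGroup G] [CompactSpace G]
  [MeasurableSpace G] [BorelSpace G] {N : ℕ} (ρ : G →* Matrix (Fin N) (Fin N) ℂ)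

/-- **Twisted time slicing — cyclic form with one marked bond** (period `1 + M + 1`): the twisted partition function
is the cyclic chain whose bond `V 0 → V 1` carries the twisted kernel `K_β(T_z V₀, V₁)` and whose other `1 + M` bonds
carry `K_β` — the shape of the hypothesis `hz` of the cyclic kernel-level statements
(`Literature.Analysis.OperatorTheory.integral_cyclic_twisted_eq_integral_iterate`, `…integral_cyclic_twisted_le`).
[cite: tHooft1979Flux, §5 (5.1)–(5.4)] [cite: MontvayMunster1994, §3.2.6 (3.145)] -/
theorem wilsonFinTorusTwistedPartition_eq_integral_cyclic [SecondCountableTopology G] (hρ : Continuous ρ)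
    (β : ℝ) {z : Fin 4 → G} (hz : ∀ i : Fin 3, z i.castSucc ∈ Subgroup.center G) (b₁ b₂ b₃ M : ℕ) :
    wilsonFinTorusTwistedPartition ρ β z b₁ b₂ b₃ (1 + M + 1) =
      ∫ V : Fin (1 + M + 1) → (FinSpatialSite b₁ b₂ b₃ × Fin 3 → G),
        finTorusSliceKernel ρ β (finSliceTwist z (V 0)) (V 1) *
          ∏ t : Fin (1 + M), finTorusSliceKernel ρ β (V t.succ) (V (t.succ + 1))
        ∂(Measure.pi fun _ => Measure.pi fun _ : FinSpatialSite b₁ b₂ b₃ × Fin 3 => haarProbability G) := by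
  rw [wilsonFinTorusTwistedPartition_eq_integral_prod_finTorusSliceKernel ρ hρ β hz b₁ b₂ b₃ (1 + M + 1)]
  refine integral_congr_ae (Eventually.of_forall fun V => ?_)
  dsimp only
  rw [Fin.prod_univ_succ]
  congr 1
  · simp
  · refine Finset.prod_congr rfl fun t _ => ?_
    have ht : ((t.succ : Fin (1 + M + 1)) : ℕ) ≠ 0 := by simp [Fin.val_succ]
    simp only [ht, if_false, finRotate_apply]

/-- The same for a period written `M + 2`. [cite: tHooft1979Flux, §5 (5.1)–(5.4)] -/
theorem wilsonFinTorusTwistedPartition_add_two_eq_integral_cyclic [SecondCountableTopology G] (hρ : Continuous ρ)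
    (β : ℝ) {z : Fin 4 → G} (hz : ∀ i : Fin 3, z i.castSucc ∈ Subgroup.center G) (b₁ b₂ b₃ M : ℕ) :
    wilsonFinTorusTwistedPartition ρ β z b₁ b₂ b₃ (M + 2) =
      ∫ V : Fin (1 + M + 1) → (FinSpatialSite b₁ b₂ b₃ × Fin 3 → G),
        finTorusSliceKernel ρ β (finSliceTwist z (V 0)) (V 1) *
          ∏ t : Fin (1 + M), finTorusSliceKernel ρ β (V t.succ) (V (t.succ + 1))
        ∂(Measure.pi fun _ => Measure.pi fun _ : FinSpatialSite b₁ b₂ b₃ × Fin 3 => haarProbability G) := by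
  rw [show M + 2 = 1 + M + 1 by ring]
  exact wilsonFinTorusTwistedPartition_eq_integral_cyclic ρ hρ β hz b₁ b₂ b₃ M

omit [TopologicalSpace G] [IsTopologicalGroup G] [CompactSpace G] [MeasurableSpace G] [BorelSpace G] in
/-- **Centre-valued twist families.**  For `c : Fin 4 → Z(G)` the underlying `G`-valued family is central in every
slot, so all the `hz : ∀ i, z i.castSucc ∈ Z(G)` hypotheses of this file are met ('t Hooft's twists are labelled by
centre elements, (4.2)). [cite: tHooft1979Flux, §4 (4.2)] -/
theorem center_coe_castSucc_mem (c : Fin 4 → Subgroup.center G) (i : Fin 3) :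
    (fun μ => (c μ : G)) i.castSucc ∈ Subgroup.center G :=
  (c i.castSucc).2

omit [TopologicalSpace G] [IsTopologicalGroup G] [CompactSpace G] [MeasurableSpace G] [BorelSpace G] in
/-- **No twist, centre-valued form**: the twist by the trivial family `1 : Fin 4 → Z(G)` is the identity
(`T 1 = id` for the family `T c = finSliceTwist (↑c)`, the `hT1` of the kernel-level statements).
[cite: tHooft1979Flux, §4 (4.2)–(4.4)] -/
theorem finSliceTwist_center_one {b₁ b₂ b₃ : ℕ} :
    (finSliceTwist (fun μ => ((1 : Fin 4 → Subgroup.center G) μ : G)) :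
      (FinSpatialSite b₁ b₂ b₃ × Fin 3 → G) → _) = id := by
  have h : (fun μ => ((1 : Fin 4 → Subgroup.center G) μ : G)) = (1 : Fin 4 → G) := by
    funext μ
    simp
  rw [h, finSliceTwist_one]

/-- **No twist, centre-valued form, for the partition function**: `Z^{(↑1)} = Z`. [cite: tHooft1979Flux, §2 (2.6)] -/
theorem wilsonFinTorusTwistedPartition_center_one (β : ℝ) (n₀ n₁ n₂ n₃ : ℕ) :
    wilsonFinTorusTwistedPartition ρ β (fun μ => ((1 : Fin 4 → Subgroup.center G) μ : G)) n₀ n₁ n₂ n₃ =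
      wilsonFinTorusPartition ρ β n₀ n₁ n₂ n₃ := by
  have h : (fun μ => ((1 : Fin 4 → Subgroup.center G) μ : G)) = (1 : Fin 4 → G) := by
    funext μ
    simp
  rw [h, wilsonFinTorusTwistedPartition_one]

end Consumer

end Literature.MathematicalPhysics.QuantumFieldTheory

end
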